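import Summits.ABC.IUTFork.Cor312HullShell
import Summits.ABC.IUTFork.Cor312RegimeVerbatimPrVolExactSupport
import Summits.ABC.IUTFork.Cor312RegimeVerbatimPrVolExactCriterion
import Literature.IUT.LogVolume.TensorPacketDyadicSplitShell
import Literature.IUT.LogVolume.LocalDegreeGlobalBounds
import HarnessLib

/-!
# [IUTchIII] Cor. 3.12 — the regime decomposition at the print-normalised sharp setting of record, VIII: the DYADIC SPLIT
# packets, `−|log(Θ)|(𝟙) = 0` for `|disc F| = 1` (i.e. over `ℚ`), and the exact criterion over `ℚ`: `Statement ⟺ Qside ≤ Θside`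

PROOF-ONLY support piece of the abc-iut cell (Cor. 3.12 cone, D-0067; seat abc-iut-w4-d107, gen 5; part 22 of the
`Cor312NegLogThetaUpperPrVol*` / `Cor312RegimeVerbatimPrVol*` chain, sequel of parts 12, 20, 21 and of the Literature brick
`TensorPacketDyadicSplitShell`). TAKES NO SIDE on [IUTchIII] Cor. 3.12; theorems only, 0 `def`s, no new `Prop` fact, no instance.

* `hshell_two_of_dyadicSplit` — at the packets over `2` of a number field in which `2` is UNRAMIFIED with all residue degrees
  `1` (2 splits completely), the log-shell lattice of every summand IS the normalised packet (the brick p450124 per summand);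
* `thetaLocal_untopD_settingPrVolSharp_trivial_eq_zero_at_two` — hence the local Θ-term of the trivial configuration at every
  packet over `2` is `0` (part 21's re-threaded exact value at the zero exponents);
* **`negLogTheta_settingPrVolSharp_trivial_eq_zero_of_dyadicSplit`** — if moreover `|disc F| = 1`, then `−|log(Θ)|(𝟙) = 0`
  (part 20: the number is a sum over `{2} ∪ {p | disc F} = {2}`);
* **`negLogTheta_settingPrVolSharp_trivial_eq_zero_rat`** — over `F = ℚ` (`disc ℚ = 1`, `ℚ_2` has `e = f = 1`): `−|log(Θ)|(𝟙) = 0`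
  for EVERY pilot datum over `ℚ` and every context;
* **`statement_settingPrVolSharp_iff_rat`** — so over `ℚ` (the toy beds of the cell's countermodels: bad mass one), for pilot
  ideles supported over odd primes, the typed [IUTchIII] Cor. 3.12 Statement at `Real.settingPrVolSharp` is EXACTLY
  `Qside ≤ Θside` — no constant at all: with the (Ind1)-symmetrisation bookkeeping of parts 7–9 it FAILS at every datum whose
  `q`-exponent mass exceeds the slot-symmetrised Θ-exponent mass (e.g. every sharp-realising datum of positive depth, bad mass
  one) and HOLDS otherwise. Contrast part 18: at every `F` with a ramified place, `−|log(Θ)|(𝟙) > 0`.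
HONEST SCOPE as in parts 7–21: (Ind2) as typed at the real setting; sharp (Ind3) reading; trivial archimedean container; free
ideles; `ℚ` is NOT the base field of any initial Θ-datum (`√−1 ∉ ℚ`) — these are the cell's toy beds; nothing here asserts or
denies [IUTchIII] Cor. 3.12 for initial Θ-data. typed ≠ proved; instantiated ≠ endorsed. [claim: Mochizuki2012, status: disputed]
[cite: DupuyHilado2025, §3.6, §3.9, §4.7] [cite: Mochizuki2012, IUTchIV Prop. 1.2 (i) p. 10, Thm 1.10 proof Step (vi) p. 29]
[cite: NeukirchANT1999, Ch. II Prop. (5.5)]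
-/

noncomputable section

open Set Function NumberField IsDedekindDomain
open scoped Pointwise

namespace Summit.ABC

namespace IUTFork

namespace Thm311

namespace Real

open Cor312 Cor312.Setting Cor312Vol Literature.IUT.LogThetaLattice Literature.IUT.LogVolume
  Literature.NumberTheory.NumberFields

variable {F : Type} [Field F] [NumberField F] (X : PilotData F) {logv : PadicLogs F} (hlog : LogvAnalytic logv)

/-! ## §1. The dyadic split packets satisfy `hshell` -/

/-- **At the packets over `2` of a field in which `2` is unramified with all residue degrees `1`, the log-shell lattice of every
summand is the normalised packet** (`TensorPacketDyadicSplitShell.logShell_eq_normalizedPacket_of_dyadicSplit` per summand; the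
`(i+2)`-capsule has `≥ 2` members). [cite: Mochizuki2012, IUTchIV Prop. 1.2 (i) p. 10] [cite: NeukirchANT1999, Ch. II Prop. (5.5)] -/
theorem hshell_two_of_dyadicSplit (hdisc : ¬ ((2 : ℕ) : ℤ) ∣ NumberField.discr F)
    (hf : ∀ v : (thetaIndex X).Fibre (.inr ⟨2, Nat.prime_two⟩),
      haveI : Fact (Nat.Prime 2) := ⟨Nat.prime_two⟩; residueDegree 2 ((presAt X hlog ⟨2, Nat.prime_two⟩).k v) = 1)
    (i : Fin (thetaIndex X).lstar) :
    haveI : Fact (Nat.Prime 2) := ⟨Nat.prime_two⟩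
    ∀ e : (thetaIndex X).Caps (Setting.labelSucc i) → (thetaIndex X).Fibre (.inr ⟨2, Nat.prime_two⟩),
      logShell ((⟨2, Nat.prime_two⟩ : Nat.Primes) : ℕ) ((presAt X hlog ⟨2, Nat.prime_two⟩).kk e) =
        (normalizedPacket ((⟨2, Nat.prime_two⟩ : Nat.Primes) : ℕ) ((presAt X hlog ⟨2, Nat.prime_two⟩).kk e) :
          Set ((presAt X hlog ⟨2, Nat.prime_two⟩).X e)) := by
  haveI : Fact (Nat.Prime 2) := ⟨Nat.prime_two⟩
  intro e
  exact logShell_eq_normalizedPacket_of_dyadicSplit ((presAt X hlog ⟨2, Nat.prime_two⟩).kk e)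
    (two_le_card_caps_labelSucc X i) (fun a => absRamificationIdx_presAt_eq_one X hlog ⟨2, Nat.prime_two⟩ hdisc (e a))
    (fun a => hf (e a))

variable (M : Type) [Field M] [NumberField M]
  (archPk : ∀ (j : (thetaIndex X).Label) (vQ : (thetaIndex X).VQ), Set ((logShellsDH X logv).Packet j vQ))
  (archSub : ∀ (j : (thetaIndex X).Label) (v : (thetaIndex X).V),
    Set ((logShellsDH X logv).Packet j ((thetaIndex X).over v)))
  (Ψ : ℤ → ∀ v : (thetaIndex X).V, v ∈ (thetaIndex X).Vbad → Set ((logShellsDH X logv).StarPacket v))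
  (act : ℤ → ∀ v : (thetaIndex X).V, v ∈ (thetaIndex X).Vbad →
    (logShellsDH X logv).StarPacket v → Module.End ℚ ((logShellsDH X logv).StarPacket v))
  (Mmod : ℤ → ∀ j : (thetaIndex X).LabelStar, Set ((logShellsDH X logv).GlobalPacket j.1))
  (region : ℤ → ∀ j : (thetaIndex X).LabelStar, FinDivisor M → ∀ vQ : (thetaIndex X).VQ,
    Set ((logShellsDH X logv).Packet j.1 vQ))
  (n : ℤ) {HT : Type} {LogLink : HT → HT → Type} {IsFull : ∀ {s t : HT}, LogLink s t → Prop}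
  (lat : LGPGaussianLogThetaLattice LogLink IsFull)
  {Frd : Type} {IsoF : Frd → Frd → Type} {Ob : Frd → Type} {realify : Frd → Frd} {Strip : Type}
  {IsoS : Strip → Strip → Type} {Mv : ∀ v : (thetaIndex X).V, v ∈ (thetaIndex X).Vbad → Type}
  [∀ v h, Monoid (Mv v h)]
  (sig : GlobalLGPFrobenioidSignature (thetaIndex X).lstar (thetaIndex X).V (· ∈ (thetaIndex X).Vbad)
    Frd IsoF Ob realify Strip IsoS Mv)
  (split : SplittingMonoids Mv) {ObΔ : Type} {N : ∀ v : (thetaIndex X).V, v ∈ (thetaIndex X).Vbad → Type}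
  [∀ v h, Monoid (N v h)] (qData : QPilotData ObΔ N)

/-! ## §2. The local term of the trivial configuration at the dyadic split packets is `0` -/

/-- **At a dyadic split packet the local Θ-term of the trivial configuration is `0`** (part 21's exact value under `hshell`
at the zero exponents). [cite: DupuyHilado2025, §3.6, §3.9] [claim: Mochizuki2012, status: disputed] -/
theorem thetaLocal_untopD_settingPrVolSharp_trivial_eq_zero_at_two (hdisc : ¬ ((2 : ℕ) : ℤ) ∣ NumberField.discr F)
    (hf : ∀ v : (thetaIndex X).Fibre (.inr ⟨2, Nat.prime_two⟩),
      haveI : Fact (Nat.Prime 2) := ⟨Nat.prime_two⟩; residueDegree 2 ((presAt X hlog ⟨2, Nat.prime_two⟩).k v) = 1)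
    (i : Fin (thetaIndex X).lstar) :
    ((settingPrVolSharp X hlog M archPk archSub Ψ act Mmod region n lat sig split qData (fun _ _ => 1) (fun _ _ _ => 1)
        (fun _ _ => one_ne_zero) (fun _ _ _ => norm_one)).thetaLocal (Setting.labelSucc i) (.inr ⟨2, Nat.prime_two⟩)).untopD 0 =
      0 := by
  haveI : Fact (Nat.Prime 2) := ⟨Nat.prime_two⟩
  haveI : Fact (((⟨2, Nat.prime_two⟩ : Nat.Primes) : ℕ)).Prime := ⟨Nat.prime_two⟩
  rw [thetaLocal_settingPrVolSharp_eq_of_zpow_of_shell X hlog (fun _ _ _ => 1) (fun _ _ => 1) M archPk archSub Ψ act Mmod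
    region n lat sig split qData (fun _ _ _ => one_ne_zero) (fun _ _ _ _ => norm_one) (fun _ _ => one_ne_zero)
    (fun _ _ _ => norm_one) i ⟨2, Nat.prime_two⟩ (hshell_two_of_dyadicSplit X hlog hdisc hf i) (fun _ => 0) (fun x => by simp),
    WithTop.untopD_coe]
  exact sum_weightPr_mul_inf'_zero_eq_zero X hlog i ⟨2, Nat.prime_two⟩

/-! ## §3. `−|log(Θ)|(𝟙) = 0` when `|disc F| = 1` and `2` splits completely — i.e. over `ℚ` -/

/-- **`−|log(Θ)|(𝟙) = 0` when `|disc(F)| = 1` and every place over `2` has residue degree `1`**: the number is the sum over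
`{2} ∪ {p | disc F} = {2}` of the unit-box local terms (part 20), and the dyadic ones vanish (§2).
[cite: DupuyHilado2025, §3.6, §3.9] [claim: Mochizuki2012, status: disputed] -/
theorem negLogTheta_settingPrVolSharp_trivial_eq_zero_of_dyadicSplit (hdisc1 : (NumberField.discr F).natAbs = 1)
    (hf : ∀ v : (thetaIndex X).Fibre (.inr ⟨2, Nat.prime_two⟩),
      haveI : Fact (Nat.Prime 2) := ⟨Nat.prime_two⟩; residueDegree 2 ((presAt X hlog ⟨2, Nat.prime_two⟩).k v) = 1) :
    (settingPrVolSharp X hlog M archPk archSub Ψ act Mmod region n lat sig split qData (fun _ _ => 1) (fun _ _ _ => 1)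
        (fun _ _ => one_ne_zero) (fun _ _ _ => norm_one)).negLogTheta = ((0 : ℝ) : WithTop ℝ) := by
  have hnd : ∀ pp : Nat.Primes, ¬ ((pp : ℕ) : ℤ) ∣ NumberField.discr F := by
    intro pp h
    have h1 : ((pp : ℕ) : ℤ).natAbs ∣ (NumberField.discr F).natAbs := Int.natAbs_dvd_natAbs.mpr h
    rw [Int.natAbs_natCast, hdisc1, Nat.dvd_one] at h1
    exact pp.2.one_lt.ne' h1
  have hdisc : ¬ ((2 : ℕ) : ℤ) ∣ NumberField.discr F := hnd ⟨2, Nat.prime_two⟩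
  rw [negLogTheta_settingPrVolSharp_trivial_eq_sum X hlog M archPk archSub Ψ act Mmod region n lat sig split qData
    {⟨2, Nat.prime_two⟩} (fun pp hpp => Finset.mem_singleton.mpr (Subtype.ext (le_antisymm hpp pp.2.two_le)))
    (fun pp h => absurd h (hnd pp))]
  congr 1
  have h0 : (fun i : Fin (thetaIndex X).lstar => ∑ pp ∈ ({⟨2, Nat.prime_two⟩} : Finset Nat.Primes),
      ((settingPrVolSharp X hlog M archPk archSub Ψ act Mmod region n lat sig split qData (fun _ _ => 1) (fun _ _ _ => 1)
        (fun _ _ => one_ne_zero) (fun _ _ _ => norm_one)).thetaLocal (Setting.labelSucc i) (.inr pp)).untopD 0) =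
      fun _ => 0 := by
    funext i
    rw [Finset.sum_singleton]
    exact thetaLocal_untopD_settingPrVolSharp_trivial_eq_zero_at_two X hlog M archPk archSub Ψ act Mmod region n lat sig split
      qData hdisc hf i
  rw [h0]
  unfold processionNormalized
  rw [Finset.sum_const_zero, zero_div]

end Real

end Thm311

end IUTFork

end Summit.ABC

/-! ## §4. Over `ℚ` -/

namespace Summit.ABC.IUTFork.Thm311.Real

open Cor312 Cor312.Setting Cor312Vol Literature.IUT.LogThetaLattice Literature.IUT.LogVolume
  Literature.NumberTheory.NumberFields

variable (X : PilotData ℚ) {logv : PadicLogs ℚ} (hlog : LogvAnalytic logv)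
  (M : Type) [Field M] [NumberField M]
  (archPk : ∀ (j : (thetaIndex X).Label) (vQ : (thetaIndex X).VQ), Set ((logShellsDH X logv).Packet j vQ))
  (archSub : ∀ (j : (thetaIndex X).Label) (v : (thetaIndex X).V),
    Set ((logShellsDH X logv).Packet j ((thetaIndex X).over v)))
  (Ψ : ℤ → ∀ v : (thetaIndex X).V, v ∈ (thetaIndex X).Vbad → Set ((logShellsDH X logv).StarPacket v))
  (act : ℤ → ∀ v : (thetaIndex X).V, v ∈ (thetaIndex X).Vbad →
    (logShellsDH X logv).StarPacket v → Module.End ℚ ((logShellsDH X logv).StarPacket v))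
  (Mmod : ℤ → ∀ j : (thetaIndex X).LabelStar, Set ((logShellsDH X logv).GlobalPacket j.1))
  (region : ℤ → ∀ j : (thetaIndex X).LabelStar, FinDivisor M → ∀ vQ : (thetaIndex X).VQ,
    Set ((logShellsDH X logv).Packet j.1 vQ))
  (n : ℤ) {HT : Type} {LogLink : HT → HT → Type} {IsFull : ∀ {s t : HT}, LogLink s t → Prop}
  (lat : LGPGaussianLogThetaLattice LogLink IsFull)
  {Frd : Type} {IsoF : Frd → Frd → Type} {Ob : Frd → Type} {realify : Frd → Frd} {Strip : Type}
  {IsoS : Strip → Strip → Type} {Mv : ∀ v : (thetaIndex X).V, v ∈ (thetaIndex X).Vbad → Type}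
  [∀ v h, Monoid (Mv v h)]
  (sig : GlobalLGPFrobenioidSignature (thetaIndex X).lstar (thetaIndex X).V (· ∈ (thetaIndex X).Vbad)
    Frd IsoF Ob realify Strip IsoS Mv)
  (split : SplittingMonoids Mv) {ObΔ : Type} {N : ∀ v : (thetaIndex X).V, v ∈ (thetaIndex X).Vbad → Type}
  [∀ v h, Monoid (N v h)] (qData : QPilotData ObΔ N)

/-- Every completion of `ℚ` at a place over `2` has residue degree `1` (`f ≤ [ℚ : ℚ] = 1`, `f ≥ 1`). [cite: NeukirchANT1999, Ch. I Prop. (8.2)] -/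
theorem residueDegree_presAt_rat_eq_one (pp : Nat.Primes) (v : (thetaIndex X).Fibre (.inr pp)) :
    haveI : Fact (pp : ℕ).Prime := ⟨pp.2⟩; residueDegree (pp : ℕ) ((presAt X hlog pp).k v) = 1 := by
  haveI : Fact (pp : ℕ).Prime := ⟨pp.2⟩
  refine le_antisymm ?_ (residueDegree_pos (pp : ℕ) _)
  have h := residueDegree_rescaledCompletion_le_finrank_rat ℚ (pp : ℕ) (placeOf X pp.1 v) (natCast_mem_placeOf X pp.1 v)
  rw [Module.finrank_self] at h
  exact h

/-- **`−|log(Θ)|(𝟙) = 0` OVER `ℚ`**: for every pilot datum over `ℚ` and every context, the Θ-volume of the trivial idele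
configuration at `Real.settingPrVolSharp` vanishes (`disc ℚ = 1`; every packet over `2` is dyadic split). Contrast part 18: it is
`> 0` over every field with a ramified place. [cite: DupuyHilado2025, §3.6, §3.9] [claim: Mochizuki2012, status: disputed] -/
theorem negLogTheta_settingPrVolSharp_trivial_eq_zero_rat :
    (settingPrVolSharp X hlog M archPk archSub Ψ act Mmod region n lat sig split qData (fun _ _ => 1) (fun _ _ _ => 1)
        (fun _ _ => one_ne_zero) (fun _ _ _ => norm_one)).negLogTheta = ((0 : ℝ) : WithTop ℝ) :=
  negLogTheta_settingPrVolSharp_trivial_eq_zero_of_dyadicSplit X hlog M archPk archSub Ψ act Mmod region n lat sig split qData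
    (by rw [Rat.numberField_discr]; rfl) (fun v => residueDegree_presAt_rat_eq_one X hlog ⟨2, Nat.prime_two⟩ v)

/-- **THE EXACT CRITERION OVER `ℚ` — NO CONSTANT.** For a pilot datum over `ℚ` whose places of `S` lie over a finite set `U` of
ODD primes, and pilot ideles (non-zero, units off `S`) with Θ-exponents `m` and `q`-exponents `m_q` over `U`:
`Statement ⟺ Qside ≤ Θside`, i.e.
`PN_i Σ_{p∈U} (−m_{q,p}·log p) ≤ PN_i Σ_{p∈U} (−min_a m_{i,p}(a)·log p)` (over `ℚ` every packet has one place; part 12's criterion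
with `−|log(Θ)|(𝟙) = 0`). The typed [IUTchIII] Cor. 3.12 at the cell's toy beds is decided by exponent bookkeeping alone; no side
taken on initial Θ-data. [claim: Mochizuki2012, status: disputed] [cite: DupuyHilado2025, §3.6, §3.9, §4.7] -/
theorem statement_settingPrVolSharp_iff_rat
    (tq : ∀ (pp : Nat.Primes) (x : (thetaIndex X).Fibre (.inr pp)), haveI : Fact (pp : ℕ).Prime := ⟨pp.2⟩; kOf X pp.1 x)
    (t : ∀ (pp : Nat.Primes) (_ : Fin X.lstar) (x : (thetaIndex X).Fibre (.inr pp)),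
      haveI : Fact (pp : ℕ).Prime := ⟨pp.2⟩; kOf X pp.1 x)
    (ht0 : ∀ pp i x, t pp i x ≠ 0)
    (ht1 : ∀ (pp : Nat.Primes) (i : Fin X.lstar) (x : (thetaIndex X).Fibre (.inr pp)),
      haveI : Fact (pp : ℕ).Prime := ⟨pp.2⟩; placeOf X pp.1 x ∉ X.S → ‖t pp i x‖ = 1)
    (htq0 : ∀ pp x, tq pp x ≠ 0)
    (htq1 : ∀ (pp : Nat.Primes) (x : (thetaIndex X).Fibre (.inr pp)),
      haveI : Fact (pp : ℕ).Prime := ⟨pp.2⟩; placeOf X pp.1 x ∉ X.S → ‖tq pp x‖ = 1)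
    (U : Finset Nat.Primes)
    (hU : ∀ (pp : Nat.Primes) (x : (thetaIndex X).Fibre (.inr pp)),
      haveI : Fact (pp : ℕ).Prime := ⟨pp.2⟩; placeOf X pp.1 x ∈ X.S → pp ∈ U)
    (hU2 : ∀ pp ∈ U, 2 < (pp : ℕ))
    (m : ∀ pp : Nat.Primes, Fin (thetaIndex X).lstar → (thetaIndex X).Fibre (.inr pp) → ℤ)
    (hm : ∀ (pp : Nat.Primes), pp ∈ U → ∀ (i : Fin (thetaIndex X).lstar) (x : (thetaIndex X).Fibre (.inr pp)),
      haveI : Fact (pp : ℕ).Prime := ⟨pp.2⟩; ‖t pp i x‖ = ‖((pp : ℕ) : ℚ_[pp]) ^ m pp i x‖)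
    (mq : ∀ pp : Nat.Primes, (thetaIndex X).Fibre (.inr pp) → ℤ)
    (hmq : ∀ (pp : Nat.Primes), pp ∈ U → ∀ (x : (thetaIndex X).Fibre (.inr pp)),
      haveI : Fact (pp : ℕ).Prime := ⟨pp.2⟩; ‖tq pp x‖ = ‖((pp : ℕ) : ℚ_[pp]) ^ mq pp x‖) :
    (settingPrVolSharp X hlog M archPk archSub Ψ act Mmod region n lat sig split qData tq t htq0 htq1).Statement ↔
      processionNormalized (fun i : Fin (thetaIndex X).lstar => ∑ pp ∈ U,
          (haveI : Fact (pp : ℕ).Prime := ⟨pp.2⟩;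
            ∑ e : (presAt X hlog pp).toLocalPieces.E (Setting.labelSucc i),
              weightPr X pp.1 (Setting.labelSucc i) e * (-(mq pp (e (Fin.last _))) * Real.log (pp : ℕ)))) ≤
        processionNormalized (fun i : Fin (thetaIndex X).lstar => ∑ pp ∈ U,
          (haveI : Fact (pp : ℕ).Prime := ⟨pp.2⟩;
            ∑ e : (presAt X hlog pp).toLocalPieces.E (Setting.labelSucc i),
              weightPr X pp.1 (Setting.labelSucc i) e *
                (-(Finset.univ.inf' Finset.univ_nonempty (fun a => m pp i (e a)) * Real.log (pp : ℕ))))) := by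
  have hUd : ∀ pp ∈ U, ¬ ((pp : ℕ) : ℤ) ∣ NumberField.discr ℚ := fun pp _ h => by
    rw [Rat.numberField_discr] at h
    have h1 := Int.eq_one_of_dvd_one (Int.natCast_nonneg _) h
    exact pp.2.one_lt.ne' (by exact_mod_cast h1)
  rw [statement_settingPrVolSharp_iff_exact X hlog M archPk archSub Ψ act Mmod region n lat sig split qData t tq ht0 ht1 htq0
    htq1 U hU hU2 hUd m hm mq hmq, negLogTheta_settingPrVolSharp_trivial_eq_zero_rat, WithTop.coe_le_coe, sub_nonpos]

end Summit.ABC.IUTFork.Thm311.Real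

end
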